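import Literature.Analysis.Complex.PuncturedPlaneEnds
import Literature.Analysis.Complex.EntireInjectiveAffine
import HarnessLib

/-!
# Biholomorphisms between finitely punctured planes, II: they are Möbius transformations

Classical: every biholomorphic map `φ : ℂ ∖ S → ℂ ∖ T` between complements of FINITE subsets of `ℂ`
is the restriction of a Möbius transformation `z ↦ (A z + B)/(C z + D)`, `A D - B C ≠ 0`
(J. B. Conway, *Functions of One Complex Variable I* (1978), Ch. V Thm. 1.21 / Def. 1.3 with Ch. III
§3; R. Remmert, *Classical Topics in Complex Function Theory*, Ch. 10 §2: injective entire / injective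
meromorphic functions).  The tree's `ThricePuncturedSphereAutomorphisms` is the case `S = T = {0, 1}`;
this file, over `PuncturedPlaneEnds`, proves the general statement:

* `PuncturedPlane.exists_eq_mul_add_of_injOn` — REMOVABLE-SINGULARITY EXTENSION LEMMA: a function
  complex differentiable and injective off a finite set `S`, proper at `∞`, with finite limits at the
  points of `S` that are pairwise distinct and not attained off `S`, is affine (it extends to an
  injective proper entire function; the tree's `exists_eq_mul_add_of_differentiable_injective`);
* `PuncturedPlane.exists_affine_of_tendsto_cocompact` — a biholomorphism `ℂ ∖ S ≃ ℂ ∖ T` fixing the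
  end `∞` is affine, `z ↦ a z + b`;
* **`PuncturedPlane.exists_moebius`** — in general it is Möbius (if `∞ ↦ q₀ ∈ T`, apply the previous
  case to `z ↦ (φ z - q₀)⁻¹`);
* `PuncturedPlane.eq_id_of_forall_tendsto` — for `|S| ≥ 2`, an automorphism of `ℂ ∖ S` under which
  every finite puncture is fixed (`f → p` at `p`, for all `p ∈ S`) is the identity — the input
  «σ fixes every puncture ⇒ σ = id» of the abc-iut cell's (H1′)-at-`ℂ ∖ F` argument ([AbsTopIII]
  Prop 4.2 (i), geometric column).

No definitions.  [cite: Conway1978, Ch. V Thm. 1.21 and Def. 1.3]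
-/

noncomputable section

namespace Literature.Analysis.Complex

namespace PuncturedPlane

open _root_.Filter _root_.Topology _root_.Metric _root_.Bornology _root_.Set _root_.Function
open scoped _root_.Manifold _root_.ContDiff
open _root_.TopologicalSpace (Opens)
open Literature.AnabelianGeometry.AbsoluteAnabelian

/-! ### Filter lemmas at the punctures -/

/-- Near a point `p` (punctured), every point avoids the finite set `S`. [cite: Conway1978, Ch. V Def. 1.3] -/
theorem eventually_not_mem_nhdsNE {S : Set ℂ} (hS : S.Finite) (p : ℂ) : ∀ᶠ z in 𝓝[≠] p, z ∉ S := by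
  have hc : IsClosed (S \ {p}) := (hS.subset fun _ h => h.1).isClosed
  have hp : p ∉ S \ {p} := fun h => h.2 rfl
  have h1 : ∀ᶠ z in 𝓝 p, z ∉ S \ {p} := hc.isOpen_compl.mem_nhds hp
  have h2 : ∀ᶠ z in 𝓝[≠] p, z ≠ p := self_mem_nhdsWithin
  filter_upwards [mem_nhdsWithin_of_mem_nhds h1, h2] with z hz hzp
  exact fun hzS => hz ⟨hzS, hzp⟩

/-- Around a point `p` there is a disc meeting the finite set `S` at most in `p`. [cite: Conway1978, Ch. V Def. 1.3] -/
theorem exists_ball_inter_subset {S : Set ℂ} (hS : S.Finite) (p : ℂ) :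
    ∃ r > 0, ∀ z ∈ ball p r, z ≠ p → z ∉ S := by
  have hc : IsClosed (S \ {p}) := (hS.subset fun _ h => h.1).isClosed
  have hp : p ∈ (S \ {p})ᶜ := fun h => h.2 rfl
  obtain ⟨r, hr, hrS⟩ := Metric.isOpen_iff.mp hc.isOpen_compl p hp
  exact ⟨r, hr, fun z hz hzp hzS => hrS hz ⟨hzS, hzp⟩⟩

/-- A punctured neighbourhood filter is not the filter at `∞`. [cite: Conway1978, Ch. V Def. 1.3] -/
theorem nhdsNE_ne_cocompact (p : ℂ) : 𝓝[≠] p ≠ cocompact ℂ := by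
  intro h
  have hA : closedBall p 1 ∈ 𝓝[≠] p := mem_nhdsWithin_of_mem_nhds (closedBall_mem_nhds _ one_pos)
  have hB : (closedBall p 1)ᶜ ∈ 𝓝[≠] p := h ▸ (isCompact_closedBall _ _).compl_mem_cocompact
  have := inter_mem hA hB
  rw [inter_compl_self, empty_mem_iff_bot] at this
  exact (NormedField.nhdsNE_neBot p).ne this

/-- Distinct points have distinct punctured neighbourhood filters. [cite: Conway1978, Ch. V Def. 1.3] -/
theorem eq_of_nhdsNE_eq {p q : ℂ} (h : 𝓝[≠] p = 𝓝[≠] q) : p = q := by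
  by_contra hne
  have hd : Disjoint (𝓝[≠] p) (𝓝[≠] q) :=
    (disjoint_nhds_nhds.mpr hne).mono nhdsWithin_le_nhds nhdsWithin_le_nhds
  rw [h, disjoint_self] at hd
  exact (NormedField.nhdsNE_neBot q).ne hd

/-- `w ↦ (w - q₀)⁻¹` maps the punctured neighbourhoods of `q₀` to `∞`. [cite: Conway1978, Ch. III §3] -/
theorem tendsto_sub_inv_nhdsNE (q₀ : ℂ) : Tendsto (fun w : ℂ => (w - q₀)⁻¹) (𝓝[≠] q₀) (cocompact ℂ) := by
  have h1 : Tendsto (fun w : ℂ => w - q₀) (𝓝[≠] q₀) (𝓝[≠] 0) := by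
    refine tendsto_nhdsWithin_iff.mpr ⟨?_, ?_⟩
    · have : Tendsto (fun w : ℂ => w - q₀) (𝓝 q₀) (𝓝 (q₀ - q₀)) := tendsto_id.sub tendsto_const_nhds
      rw [sub_self] at this
      exact this.mono_left nhdsWithin_le_nhds
    · exact eventually_mem_nhdsWithin.mono fun w (hw : w ≠ q₀) h => hw (sub_eq_zero.mp h)
  have h2 : Tendsto (fun z : ℂ => z⁻¹) (𝓝[≠] 0) (cocompact ℂ) := by
    rw [← cobounded_eq_cocompact]; exact tendsto_inv₀_nhdsNE_zero
  exact h2.comp h1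

/-- `w ↦ (w - q₀)⁻¹` maps `∞` to `0`. [cite: Conway1978, Ch. III §3] -/
theorem tendsto_sub_inv_cocompact (q₀ : ℂ) : Tendsto (fun w : ℂ => (w - q₀)⁻¹) (cocompact ℂ) (𝓝 0) := by
  have h1 : Tendsto (fun w : ℂ => w - q₀) (cocompact ℂ) (cocompact ℂ) := by
    have ha : Tendsto (fun w : ℂ => ‖w‖ + -‖q₀‖) (cocompact ℂ) atTop :=
      tendsto_atTop_add_const_right _ _ tendsto_norm_cocompact_atTop
    have hb : Tendsto (fun w : ℂ => ‖w - q₀‖) (cocompact ℂ) atTop :=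
      tendsto_atTop_mono (fun w => by linarith [norm_sub_norm_le w q₀]) ha
    rw [← cobounded_eq_cocompact] at hb ⊢
    exact tendsto_norm_atTop_iff_cobounded.mp hb
  have h2 : Tendsto (fun z : ℂ => z⁻¹) (cocompact ℂ) (𝓝 0) := by
    rw [← cobounded_eq_cocompact]; exact tendsto_inv₀_cobounded
  exact h2.comp h1

/-! ### The removable-singularity extension lemma -/

/-- **Injective + proper + removable ⇒ affine.**  Let `S ⊆ ℂ` be finite and `g : ℂ → ℂ` be complex
differentiable and injective off `S` and proper at `∞`; suppose that at every `p ∈ S`, `g` has a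
finite limit `L p` (punctured sense), that these limits are pairwise distinct and are not attained by
`g` off `S`.  Then `g z = a z + b` off `S`, `a ≠ 0`: the extension of `g` by `L` on `S` is an
injective proper ENTIRE function (Riemann's removable singularity theorem), hence affine.
[cite: Conway1978, Ch. V Thm. 1.21 and Def. 1.3] -/
theorem exists_eq_mul_add_of_injOn {S : Set ℂ} (hS : S.Finite) {g : ℂ → ℂ} (L : ℂ → ℂ)
    (hd : ∀ z ∉ S, DifferentiableAt ℂ g z) (hinj : InjOn g Sᶜ)
    (hprop : Tendsto g (cocompact ℂ) (cocompact ℂ))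
    (hlim : ∀ p ∈ S, Tendsto g (𝓝[≠] p) (𝓝 (L p)))
    (hLval : ∀ p ∈ S, ∀ z ∉ S, g z ≠ L p) (hLinj : InjOn L S) :
    ∃ a b : ℂ, a ≠ 0 ∧ ∀ z ∉ S, g z = a * z + b := by
  classical
  let G : ℂ → ℂ := fun z => if z ∈ S then L z else g z
  have hGS : ∀ z ∉ S, G z = g z := fun z hz => by simp only [G, if_neg hz]
  have hGp : ∀ p ∈ S, G p = L p := fun p hp => by simp only [G, if_pos hp]
  have hSo : IsOpen Sᶜ := hS.isClosed.isOpen_compl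
  -- `G = g` near every point off `S`, near every puncture (punctured) and near `∞`
  have hGg : ∀ z ∉ S, G =ᶠ[𝓝 z] g := fun z hz =>
    Filter.eventually_of_mem (hSo.mem_nhds hz) fun y hy => hGS y hy
  have hGg' : ∀ p, G =ᶠ[𝓝[≠] p] g := fun p =>
    (eventually_not_mem_nhdsNE hS p).mono fun y hy => hGS y hy
  have hGgi : G =ᶠ[cocompact ℂ] g :=
    Filter.eventually_of_mem hS.isCompact.compl_mem_cocompact fun y hy => hGS y hy
  -- differentiability off `S`
  have hdS : ∀ z ∉ S, DifferentiableAt ℂ G z := fun z hz => (hd z hz).congr_of_eventuallyEq (hGg z hz)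
  -- differentiability at the punctures (removable singularities)
  have hdp : ∀ p ∈ S, DifferentiableAt ℂ G p := by
    intro p hp
    have hc : ContinuousAt G p := by
      rw [← continuousWithinAt_compl_self, ContinuousWithinAt, hGp p hp]
      exact (hlim p hp).congr' (hGg' p).symm
    obtain ⟨r, hr, hrS⟩ := exists_ball_inter_subset hS p
    have h := (Complex.differentiableOn_compl_singleton_and_continuousAt_iff
      (ball_mem_nhds p hr)).mp ⟨fun z hz => (hdS z (hrS z hz.1 hz.2)).differentiableWithinAt, hc⟩
    exact h.differentiableAt (ball_mem_nhds _ hr)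
  have hdiff : Differentiable ℂ G := fun z => by
    by_cases hz : z ∈ S
    · exact hdp z hz
    · exact hdS z hz
  -- injectivity
  have hinj' : Injective G := by
    intro z z' h
    by_cases hz : z ∈ S <;> by_cases hz' : z' ∈ S
    · rw [hGp z hz, hGp z' hz'] at h
      exact hLinj hz hz' h
    · rw [hGp z hz, hGS z' hz'] at h
      exact absurd h.symm (hLval z hz z' hz')
    · rw [hGS z hz, hGp z' hz'] at h
      exact absurd h (hLval z' hz' z hz)
    · rw [hGS z hz, hGS z' hz'] at h
      exact hinj hz hz' h
  -- properness, and the affine conclusion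
  have hprop' : Tendsto G (cocompact ℂ) (cocompact ℂ) := hprop.congr' hGgi.symm
  obtain ⟨a, b, ha, hab⟩ := exists_eq_mul_add_of_differentiable_injective hdiff hinj' hprop'
  exact ⟨a, b, ha, fun z hz => by rw [← hGS z hz, hab z]⟩

/-! ### Biholomorphisms `ℂ ∖ S ≃ ℂ ∖ T` -/

section Biholomorphism

variable {S T : Set ℂ} {U V : Opens ℂ} (hU : (U : Set ℂ) = Sᶜ) (hV : (V : Set ℂ) = Tᶜ)
  {φ : U ≃ₜ V} {f : ℂ → ℂ}

include hU hV in
/-- For a biholomorphism `ℂ ∖ S ≃ ℂ ∖ T` along which the end `∞` does NOT go to a given end `l₀` of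
`ℂ ∖ T`, every finite puncture `p ∈ S` goes to an end of `ℂ ∖ T` other than `l₀`'s preimage… precisely:
if `f → lInf` at `∞` then at each `p ∈ S`, `f` tends to an end `≠ lInf`. [cite: Conway1978, Ch. V Thm. 1.21 and Def. 1.3] -/
theorem exists_end_ne_of_mem (hS : S.Finite) (hT : T.Finite) (hφ : MDifferentiable 𝓘(ℂ, ℂ) 𝓘(ℂ, ℂ) φ)
    (hf : ∀ x : U, (φ x : ℂ) = f x) {lInf : Filter ℂ} (hlInf : lInf = cocompact ℂ ∨ ∃ q ∈ T, lInf = 𝓝[≠] q)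
    (hInf : Tendsto f (cocompact ℂ) lInf) {p : ℂ} (hp : p ∈ S) :
    ∃ l' : Filter ℂ, (l' = cocompact ℂ ∨ ∃ q ∈ T, l' = 𝓝[≠] q) ∧ l' ≠ lInf ∧ Tendsto f (𝓝[≠] p) l' := by
  obtain ⟨l', hl', h⟩ := end_trichotomy hU hV hS hφ hf (Or.inr ⟨p, hp, rfl⟩)
  refine ⟨l', hl', fun he => ?_, h⟩
  subst he
  exact nhdsNE_ne_cocompact p
    (end_injective hU hV hS hT hφ hf (Or.inr ⟨p, hp, rfl⟩) (Or.inl rfl) hl' h hInf)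

include hU hV in
/-- **A biholomorphism `ℂ ∖ S ≃ ℂ ∖ T` fixing `∞` is affine**: if `f → ∞` at `∞` then
`φ z = a z + b` (`a ≠ 0`).  At each `p ∈ S`, `f` tends to a finite puncture `q_p ∈ T` (the end `∞` is
taken), and the extension lemma applies to `f` with `L p = q_p`. [cite: Conway1978, Ch. V Thm. 1.21 and Def. 1.3] -/
theorem exists_affine_of_tendsto_cocompact (hS : S.Finite) (hT : T.Finite)
    (hφ : MDifferentiable 𝓘(ℂ, ℂ) 𝓘(ℂ, ℂ) φ) (hf : ∀ x : U, (φ x : ℂ) = f x)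
    (hInf : Tendsto f (cocompact ℂ) (cocompact ℂ)) :
    ∃ a b : ℂ, a ≠ 0 ∧ ∀ x : U, (φ x : ℂ) = a * x + b := by
  -- the finite punctures go to finite punctures
  have hends : ∀ p ∈ S, ∃ q ∈ T, Tendsto f (𝓝[≠] p) (𝓝[≠] q) := by
    intro p hp
    obtain ⟨l', hl', hne, h⟩ := exists_end_ne_of_mem hU hV hS hT hφ hf (Or.inl rfl) hInf hp
    rcases hl' with rfl | ⟨q, hq, rfl⟩
    · exact (hne rfl).elim
    · exact ⟨q, hq, h⟩
  choose! L hLT hL using hends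
  have hUS : ∀ {z : ℂ}, z ∉ S → z ∈ U := fun hz => (mem_iff hU).mpr hz
  obtain ⟨a, b, ha, hab⟩ := exists_eq_mul_add_of_injOn hS L
    (fun z hz => differentiableAt hφ hf (hUS hz))
    (fun z hz z' hz' h => injOn hf (hUS hz) (hUS hz') h) hInf
    (fun p hp => (hL p hp).mono_right nhdsWithin_le_nhds)
    (fun p hp z hz h => (mem_iff hV).mp (apply_mem hf (hUS hz)) (h ▸ hLT p hp))
    (fun p hp p' hp' h => eq_of_nhdsNE_eq
      (end_injective hU hV hS hT hφ hf (Or.inr ⟨p, hp, rfl⟩) (Or.inr ⟨p', hp', rfl⟩)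
        (Or.inr ⟨L p, hLT p hp, rfl⟩) (hL p hp) (h ▸ hL p' hp')))
  exact ⟨a, b, ha, fun x => by rw [hf]; exact hab x ((mem_iff hU).mp x.2)⟩

include hU hV in
/-- **Biholomorphisms between finitely punctured planes are Möbius transformations.**  For finite
`S, T ⊆ ℂ` and a holomorphic homeomorphism `φ : ℂ ∖ S ≃ₜ ℂ ∖ T` there are `A B C D` with
`A D - B C ≠ 0`, `C z + D ≠ 0` and `φ z = (A z + B)/(C z + D)` on `ℂ ∖ S`.  (If `∞ ↦ ∞`: affine; if
`∞ ↦ q₀ ∈ T`: `z ↦ (φ z - q₀)⁻¹` is proper at `∞`, injective and differentiable off `S` with distinct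
unattained finite limits at the points of `S`, hence affine `a z + b`, and `φ z = q₀ + (a z + b)⁻¹`.)
[cite: Conway1978, Ch. V Thm. 1.21 and Def. 1.3] -/
theorem exists_moebius (hS : S.Finite) (hT : T.Finite) (hφ : MDifferentiable 𝓘(ℂ, ℂ) 𝓘(ℂ, ℂ) φ)
    (hf : ∀ x : U, (φ x : ℂ) = f x) :
    ∃ A B C D : ℂ, A * D - B * C ≠ 0 ∧
      ∀ x : U, C * x + D ≠ 0 ∧ (φ x : ℂ) = (A * x + B) / (C * x + D) := by
  have hUS : ∀ {z : ℂ}, z ∉ S → z ∈ U := fun hz => (mem_iff hU).mpr hz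
  -- where does `∞` go?
  obtain ⟨lInf, hlInf, hInf⟩ := end_trichotomy hU hV hS hφ hf (Or.inl rfl)
  rcases hlInf with rfl | ⟨q₀, hq₀, rfl⟩
  · -- `∞ ↦ ∞`: affine
    obtain ⟨a, b, ha, hab⟩ := exists_affine_of_tendsto_cocompact hU hV hS hT hφ hf hInf
    refine ⟨a, b, 0, 1, by simpa using ha, fun x => ⟨by simp, ?_⟩⟩
    rw [hab x]; simp
  · -- `∞ ↦ q₀`: `g := (f - q₀)⁻¹` is affine
    set g : ℂ → ℂ := fun z => (f z - q₀)⁻¹ with hg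
    have hfq : ∀ z ∉ S, f z - q₀ ≠ 0 := fun z hz h =>
      (mem_iff hV).mp (apply_mem hf (hUS hz)) ((sub_eq_zero.mp h) ▸ hq₀)
    -- at each `p ∈ S`: `f` tends to `∞` or to some `t ∈ T`, `t ≠ q₀`; record the limit of `g`
    have hlim : ∀ p ∈ S, ∃ Lp : ℂ, Tendsto g (𝓝[≠] p) (𝓝 Lp) ∧
        ((Lp = 0 ∧ Tendsto f (𝓝[≠] p) (cocompact ℂ)) ∨
          ∃ t ∈ T, t ≠ q₀ ∧ Lp = (t - q₀)⁻¹ ∧ Tendsto f (𝓝[≠] p) (𝓝[≠] t)) := by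
      intro p hp
      obtain ⟨l', hl', hne, h⟩ :=
        exists_end_ne_of_mem hU hV hS hT hφ hf (Or.inr ⟨q₀, hq₀, rfl⟩) hInf hp
      rcases hl' with rfl | ⟨t, ht, rfl⟩
      · exact ⟨0, (tendsto_sub_inv_cocompact q₀).comp h, Or.inl ⟨rfl, h⟩⟩
      · have htq : t ≠ q₀ := fun e => hne (by rw [e])
        have hc : ContinuousAt (fun w : ℂ => (w - q₀)⁻¹) t :=
          (continuousAt_id.sub continuousAt_const).inv₀ (sub_ne_zero.mpr htq)
        exact ⟨(t - q₀)⁻¹, hc.tendsto.comp (h.mono_right nhdsWithin_le_nhds),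
          Or.inr ⟨t, ht, htq, rfl, h⟩⟩
    choose! L hL hLcases using hlim
    obtain ⟨a, b, ha, hab⟩ := exists_eq_mul_add_of_injOn hS L
      (fun z hz => ((differentiableAt hφ hf (hUS hz)).sub_const q₀).inv (hfq z hz))
      (fun z hz z' hz' h => injOn hf (hUS hz) (hUS hz')
        (sub_left_injective (inv_injective h) : f z = f z'))
      ((tendsto_sub_inv_nhdsNE q₀).comp hInf) hL
      (by
        intro p hp z hz h
        rcases hLcases p hp with ⟨h0, -⟩ | ⟨t, ht, htq, hLt, -⟩
        · exact (inv_ne_zero (hfq z hz)) (h.trans h0)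
        · rw [hLt] at h
          have hft : f z = t := by
            have := inv_injective h
            exact sub_left_injective this
          exact (mem_iff hV).mp (apply_mem hf (hUS hz)) (hft ▸ ht))
      (by
        intro p hp p' hp' h
        rcases hLcases p hp with ⟨h0, hc⟩ | ⟨t, ht, htq, hLt, hc⟩ <;>
          rcases hLcases p' hp' with ⟨h0', hc'⟩ | ⟨t', ht', htq', hLt', hc'⟩
        · exact eq_of_nhdsNE_eq (end_injective hU hV hS hT hφ hf (Or.inr ⟨p, hp, rfl⟩)
            (Or.inr ⟨p', hp', rfl⟩) (Or.inl rfl) hc hc')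
        · exact absurd (h0 ▸ hLt' ▸ h : (0 : ℂ) = (t' - q₀)⁻¹).symm (inv_ne_zero (sub_ne_zero.mpr htq'))
        · exact absurd (hLt ▸ h0' ▸ h : (t - q₀)⁻¹ = 0) (inv_ne_zero (sub_ne_zero.mpr htq))
        · have htt : t = t' := by
            have h' : (t - q₀)⁻¹ = (t' - q₀)⁻¹ := hLt ▸ hLt' ▸ h
            exact sub_left_injective (inv_injective h')
          subst htt
          exact eq_of_nhdsNE_eq (end_injective hU hV hS hT hφ hf (Or.inr ⟨p, hp, rfl⟩)
            (Or.inr ⟨p', hp', rfl⟩) (Or.inr ⟨t, ht, rfl⟩) hc hc'))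
    -- `(f z - q₀)⁻¹ = a z + b`, so `φ z = (q₀ a z + (q₀ b + 1))/(a z + b)`
    refine ⟨q₀ * a, q₀ * b + 1, a, b, ?_, fun x => ?_⟩
    · have : q₀ * a * b - (q₀ * b + 1) * a = -a := by ring
      rw [this]; exact neg_ne_zero.mpr ha
    · have hxS : (x : ℂ) ∉ S := (mem_iff hU).mp x.2
      have hgx : (f x - q₀)⁻¹ = a * x + b := hab x hxS
      have hne : a * x + b ≠ 0 := by rw [← hgx]; exact inv_ne_zero (hfq x hxS)
      refine ⟨hne, ?_⟩
      have hfx : f x = q₀ + (a * x + b)⁻¹ := by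
        rw [← hgx, inv_inv]; ring
      rw [hf, hfx]
      field_simp
      ring

end Biholomorphism

/-! ### Automorphisms of `ℂ ∖ S` -/

section Aut

variable {S : Set ℂ} {U : Opens ℂ} (hU : (U : Set ℂ) = Sᶜ) {φ : U ≃ₜ U} {f : ℂ → ℂ}

include hU in
/-- **Every biholomorphic automorphism of a finitely punctured plane is a Möbius transformation**
(`φ ∈ holAut U`, [AbsTopIII] Def. 2.1 (i), `U = ℂ ∖ S`, `S` finite). [cite: Conway1978, Ch. V Thm. 1.21 and Def. 1.3] -/
theorem exists_moebius_of_mem_holAut (hS : S.Finite) (hφ : φ ∈ holAut U)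
    (hf : ∀ x : U, (φ x : ℂ) = f x) :
    ∃ A B C D : ℂ, A * D - B * C ≠ 0 ∧
      ∀ x : U, C * x + D ≠ 0 ∧ (φ x : ℂ) = (A * x + B) / (C * x + D) :=
  exists_moebius hU hU hS hS ((mem_holAut_iff φ).mp hφ).1 hf

include hU in
/-- **An automorphism of `ℂ ∖ S` (`|S| ≥ 2`) fixing every finite puncture is the identity**: if
`f → p` at every `p ∈ S` then `φ = id`.  (The end `∞` is then fixed too — every finite end is taken —
so `φ` is affine, `a z + b`, fixing two distinct points of `S`.)  This is the step «σ fixes the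
punctures pointwise ⇒ σ = id» of the cell's (H1′) argument at `ℂ ∖ F`.
[cite: Conway1978, Ch. V Thm. 1.21 and Def. 1.3] -/
theorem eq_id_of_forall_tendsto (hS : S.Finite) {p₁ p₂ : ℂ} (hp₁ : p₁ ∈ S) (hp₂ : p₂ ∈ S)
    (hp : p₁ ≠ p₂) (hφ : MDifferentiable 𝓘(ℂ, ℂ) 𝓘(ℂ, ℂ) φ) (hf : ∀ x : U, (φ x : ℂ) = f x)
    (hfix : ∀ p ∈ S, Tendsto f (𝓝[≠] p) (𝓝 p)) : ∀ x : U, φ x = x := by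
  have hUS : ∀ {z : ℂ}, z ∉ S → z ∈ U := fun hz => (mem_iff hU).mpr hz
  -- the finite punctures are fixed in the punctured sense
  have hfix' : ∀ p ∈ S, Tendsto f (𝓝[≠] p) (𝓝[≠] p) := fun p hp =>
    tendsto_nhdsWithin_iff.mpr ⟨hfix p hp, (eventually_not_mem_nhdsNE hS p).mono fun z hz h =>
      (mem_iff hU).mp (apply_mem hf (hUS hz)) (h ▸ hp)⟩
  -- hence `∞ ↦ ∞`
  have hInf : Tendsto f (cocompact ℂ) (cocompact ℂ) := by
    obtain ⟨lInf, hlInf, h⟩ := end_trichotomy hU hU hS hφ hf (Or.inl rfl)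
    rcases hlInf with rfl | ⟨q, hq, rfl⟩
    · exact h
    · exact absurd (end_injective hU hU hS hS hφ hf (Or.inl rfl) (Or.inr ⟨q, hq, rfl⟩)
        (Or.inr ⟨q, hq, rfl⟩) h (hfix' q hq)).symm (nhdsNE_ne_cocompact q)
  obtain ⟨a, b, ha, hab⟩ := exists_affine_of_tendsto_cocompact hU hU hS hS hφ hf hInf
  -- the affine map fixes `p₁` and `p₂`
  have hval : ∀ p ∈ S, a * p + b = p := by
    intro p hp
    haveI : (𝓝[≠] p).NeBot := NormedField.nhdsNE_neBot p
    have h1 : Tendsto (fun z => a * z + b) (𝓝[≠] p) (𝓝 (a * p + b)) :=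
      ((continuous_const.mul continuous_id).add continuous_const).continuousAt.tendsto.mono_left
        nhdsWithin_le_nhds
    have h2 : Tendsto (fun z => a * z + b) (𝓝[≠] p) (𝓝 p) :=
      (hfix p hp).congr' ((eventually_not_mem_nhdsNE hS p).mono fun z hz => by
        rw [← hf ⟨z, hUS hz⟩, hab])
    exact tendsto_nhds_unique h1 h2
  have ha1 : a = 1 := by
    have e1 := hval p₁ hp₁
    have e2 := hval p₂ hp₂
    have : a * (p₁ - p₂) = p₁ - p₂ := by linear_combination e1 - e2
    have hne : p₁ - p₂ ≠ 0 := sub_ne_zero.mpr hp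
    exact mul_right_cancel₀ hne (by rw [one_mul]; exact this)
  have hb0 : b = 0 := by have := hval p₁ hp₁; rw [ha1, one_mul] at this; linear_combination this
  intro x
  apply Subtype.ext
  rw [hab x, ha1, hb0, one_mul, add_zero]

include hU in
/-- The same for `φ ∈ holAut U`. [cite: Conway1978, Ch. V Thm. 1.21 and Def. 1.3] -/
theorem eq_id_of_mem_holAut_of_forall_tendsto (hS : S.Finite) {p₁ p₂ : ℂ} (hp₁ : p₁ ∈ S)
    (hp₂ : p₂ ∈ S) (hp : p₁ ≠ p₂) (hφ : φ ∈ holAut U) (hf : ∀ x : U, (φ x : ℂ) = f x)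
    (hfix : ∀ p ∈ S, Tendsto f (𝓝[≠] p) (𝓝 p)) : φ = 1 :=
  Homeomorph.ext (eq_id_of_forall_tendsto hU hS hp₁ hp₂ hp ((mem_holAut_iff φ).mp hφ).1 hf hfix)

end Aut

end PuncturedPlane

end Literature.Analysis.Complex

end
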